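import Literature.Probability.LatticeModels.KilledWalkGreen
import Literature.Probability.LatticeModels.BoundaryHarnackContraction
import HarnessLib

/-!
# The entrance decomposition of the exit kernel through an inner region

Topic `Literature/Probability/LatticeModels` (continuation of `KilledWalkGreen.lean`,
`KilledWalkLaplacian.lean`, `BoundaryHarnackContraction.lean`). Let `S ⊆ S'` be finite regions
of the edge-killed walk `Gr` (inner region `S`, whose exit set lies inside `S'`) and put
`Λ = S' ∖ S` (the "annulus"). For `w ∈ S'` and an exit point `x ∉ S'` the exit kernel of the big
region is the annulus kernel plus a **nonnegative mixture of annulus kernels over the entrance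
points**:

  `killedPoisson S' w x = killedPoisson Λ w x + ∑_{m ∈ Λ} ν(w,m) · killedPoisson Λ m x`,
  `ν(w,m) = ¼ ∑_{y ∼ m, y ∈ S} G_{S'}(w,y)`

(`entranceWeight`: the expected number of entrances into `Λ` at `m` from `S`; for a start `u ∈ S`
the first term vanishes). This is Lawler–Limic's last-exit decomposition read at the inner
interface (`killedPoisson_eq_add_sum_entranceWeight_mul`). The proof is analytic: the right-hand
side is killed-harmonic on `S'` — the Green functions' defining identity
`killedAvg G(·,y) - G(·,y) = -𝟙_y` cancels exactly the entrance terms at the sites of `S`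
(`sum_correction_eq`) — with the same exit data, so the two sides agree by uniqueness.
Consequence (`crossRatio_of_annulus`): a cross-ratio bound for the annulus kernels over
(entrance layer) × (two exits) passes, with the same constant, to the big-region kernels over
`S` × (two exits) (`BoundaryHarnackContraction.crossRatio_mixture`) — the reduction of
Chelkak–Wan's Proposition 3.6 for the germ regions to the lattice quadrilateral between two gates.

Everything is proved. [cite: LawlerLimic2010, §6.2 (last-exit decomposition); ChelkakWan2021, §3.2 (3.6)]
-/

noncomputable section

open scoped Classical

namespace Literature.Probability.LatticeModels

open Finset

variable {Gr : SimpleGraph (Site 2)}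

/-! ### Entrance weights -/

/-- **Entrance weight** `ν(u,m) = ¼ ∑_{e : m ∼ m+e, m+e ∈ S} G_{S'}(u, m+e)`: the expected number
of entrances at `m` from `S` of the walk started at `u` and stopped on leaving `S'`.
[cite: LawlerLimic2010, §6.2] -/
def entranceWeight (Gr : SimpleGraph (Site 2)) (S' S : Set (Site 2)) (u m : Site 2) : ℝ :=
  4⁻¹ * ∑ e : SRW.Dir 2,
    if Gr.Adj m (m + SRW.stepVec e) ∧ m + SRW.stepVec e ∈ S then killedRegionGreen Gr S' u (m + SRW.stepVec e) else 0

/-- Entrance weights are nonnegative. [folklore] -/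
theorem entranceWeight_nonneg (S' S : Set (Site 2)) (u m : Site 2) : 0 ≤ entranceWeight Gr S' S u m := by
  unfold entranceWeight
  refine mul_nonneg (by norm_num) (Finset.sum_nonneg fun e _ => ?_)
  split_ifs
  · exact killedRegionGreen_nonneg _ _ _
  · exact le_rfl

/-- Entrance weights vanish when the start is outside `S'`. [folklore] -/
theorem entranceWeight_of_not_mem {S' S : Set (Site 2)} {u : Site 2} (hu : u ∉ S') (m : Site 2) :
    entranceWeight Gr S' S u m = 0 := by
  unfold entranceWeight
  rw [Finset.sum_eq_zero fun e _ => ?_, mul_zero]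
  split_ifs
  · exact killedRegionGreen_of_not_mem_left _ hu _
  · rfl

/-- Entrance weights vanish at sites with no inner neighbour. [folklore] -/
theorem entranceWeight_eq_zero_of_forall {S' S : Set (Site 2)} (u : Site 2) {m : Site 2}
    (hm : ∀ e : SRW.Dir 2, ¬ (Gr.Adj m (m + SRW.stepVec e) ∧ m + SRW.stepVec e ∈ S)) :
    entranceWeight Gr S' S u m = 0 := by
  unfold entranceWeight
  rw [Finset.sum_eq_zero fun e _ => if_neg (hm e), mul_zero]

/-- The killed average of `u ↦ ν(u,m)` at `w ∈ S'`: `ν(w,m)` minus the pole corrections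
`¼ ∑_e 𝟙[m ∼ m+e ∈ S, w = m+e]`. [folklore] -/
theorem killedAvg_entranceWeight {S' S : Set (Site 2)} (hS' : S'.Finite) (hSS' : S ⊆ S') (m : Site 2)
    {w : Site 2} (hw : w ∈ S') :
    killedAvg Gr (fun u => entranceWeight Gr S' S u m) w =
      entranceWeight Gr S' S w m -
        4⁻¹ * ∑ e : SRW.Dir 2, if Gr.Adj m (m + SRW.stepVec e) ∧ m + SRW.stepVec e ∈ S ∧ w = m + SRW.stepVec e then 1 else 0 := by
  have expand : (fun u => entranceWeight Gr S' S u m) = fun u => 4⁻¹ * ∑ e ∈ (Finset.univ : Finset (SRW.Dir 2)),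
      (fun e u => if Gr.Adj m (m + SRW.stepVec e) ∧ m + SRW.stepVec e ∈ S
        then killedRegionGreen Gr S' u (m + SRW.stepVec e) else 0) e u := rfl
  rw [expand, killedAvg_const_mul, killedAvg_finset_sum, entranceWeight, ← mul_sub, ← Finset.sum_sub_distrib]
  congr 1
  refine Finset.sum_congr rfl fun e _ => ?_
  by_cases h : Gr.Adj m (m + SRW.stepVec e) ∧ m + SRW.stepVec e ∈ S
  · simp only [h, and_self, if_true, true_and]
    have key := killedAvg_killedRegionGreen_sub (Gr := Gr) hS' (hSS' h.2) w hw
    linarith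
  · have h' : ¬ (Gr.Adj m (m + SRW.stepVec e) ∧ m + SRW.stepVec e ∈ S ∧ w = m + SRW.stepVec e) :=
      fun h' => h ⟨h'.1, h'.2.1⟩
    simp only [h, h', if_false, sub_zero]
    simp [killedAvg]

/-- **The pole corrections are the entrance sum.** For `w ∈ S`:
`∑_{m ∈ Λ} (¼ ∑_e 𝟙[m ∼ m+e ∈ S, w = m+e]) F m = ¼ ∑_e 𝟙[w ∼ w+e ∈ Λ] F (w+e)` (reindex by the
opposite direction). [folklore] -/
theorem sum_correction_eq {S Λ : Set (Site 2)} (Λf : Finset (Site 2)) (hΛf : ∀ m, m ∈ Λf ↔ m ∈ Λ)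
    (F : Site 2 → ℝ) {w : Site 2} (hw : w ∈ S) :
    ∑ m ∈ Λf, (4⁻¹ * ∑ e : SRW.Dir 2,
        if Gr.Adj m (m + SRW.stepVec e) ∧ m + SRW.stepVec e ∈ S ∧ w = m + SRW.stepVec e then (1 : ℝ) else 0) * F m =
      4⁻¹ * ∑ e : SRW.Dir 2, if Gr.Adj w (w + SRW.stepVec e) ∧ w + SRW.stepVec e ∈ Λ then F (w + SRW.stepVec e) else 0 := by
  -- each `m`-term, reindexed by the opposite direction
  have hterm : ∀ m : Site 2, (4⁻¹ * ∑ e : SRW.Dir 2,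
      if Gr.Adj m (m + SRW.stepVec e) ∧ m + SRW.stepVec e ∈ S ∧ w = m + SRW.stepVec e then (1 : ℝ) else 0) * F m =
      4⁻¹ * ∑ e : SRW.Dir 2, if Gr.Adj w (w + SRW.stepVec e) ∧ w + SRW.stepVec e = m then F m else 0 := by
    intro m
    rw [mul_comm, ← mul_assoc, mul_comm (F m), mul_assoc, Finset.mul_sum]
    congr 1
    refine Finset.sum_nbij' (fun e => e.neg) (fun e => e.neg) (by simp) (by simp) (by simp) (by simp) ?_
    intro e _
    rw [SRW.stepVec_neg]
    by_cases hc : Gr.Adj m (m + SRW.stepVec e) ∧ m + SRW.stepVec e ∈ S ∧ w = m + SRW.stepVec e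
    · obtain ⟨hadj, hS, hwm⟩ := hc
      have hm : w + -SRW.stepVec e = m := by rw [hwm]; abel
      have hadj' : Gr.Adj w (w + -SRW.stepVec e) := by rw [hm, hwm]; exact hadj.symm
      rw [if_pos ⟨hadj, hS, hwm⟩, if_pos ⟨hadj', hm⟩, mul_one]
    · rw [if_neg hc, mul_zero, if_neg]
      rintro ⟨hadj', hm⟩
      apply hc
      have hwm : w = m + SRW.stepVec e := by rw [← hm]; abel
      have h1 : Gr.Adj m w := (hm ▸ hadj').symm
      have h2 : Gr.Adj m (m + SRW.stepVec e) := by rw [hwm] at h1; exact h1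
      exact ⟨h2, hwm ▸ hw, hwm⟩
  rw [Finset.sum_congr rfl fun m _ => hterm m, ← Finset.mul_sum, Finset.sum_comm]
  congr 1
  refine Finset.sum_congr rfl fun e _ => ?_
  by_cases ha : Gr.Adj w (w + SRW.stepVec e)
  · by_cases hz : w + SRW.stepVec e ∈ Λ
    · rw [Finset.sum_eq_single (w + SRW.stepVec e)
        (fun m _ hne => if_neg fun h : Gr.Adj w (w + SRW.stepVec e) ∧ w + SRW.stepVec e = m => hne h.2.symm)
        (fun hnot => absurd ((hΛf _).2 hz) hnot), if_pos ⟨ha, rfl⟩, if_pos ⟨ha, hz⟩]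
    · rw [if_neg fun h => hz h.2]
      exact Finset.sum_eq_zero fun m hm =>
        if_neg fun h : Gr.Adj w (w + SRW.stepVec e) ∧ w + SRW.stepVec e = m => hz (h.2 ▸ (hΛf m).1 hm)
  · rw [if_neg fun h => ha h.1]
    exact Finset.sum_eq_zero fun m _ => if_neg fun h : Gr.Adj w (w + SRW.stepVec e) ∧ w + SRW.stepVec e = m => ha h.1

/-! ### The decomposition -/

/-- **The entrance decomposition.** For finite `S'`, `S ⊆ S'` with `killedOuterBoundary Gr S ⊆ S'`
and an exit point `x ∉ S'`: on `S'`,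
`killedPoisson S' w x = killedPoisson (S' ∖ S) w x + ∑_{m ∈ S' ∖ S} ν(w,m) killedPoisson (S' ∖ S) m x`.
[cite: LawlerLimic2010, §6.2] -/
theorem killedPoisson_eq_add_sum_entranceWeight_mul {S' S : Set (Site 2)} (hS' : S'.Finite) (hSS' : S ⊆ S')
    (hOB : killedOuterBoundary Gr S ⊆ S') {x : Site 2} (hx : x ∉ S')
    (Λf : Finset (Site 2)) (hΛf : ∀ m, m ∈ Λf ↔ m ∈ S' \ S) :
    ∀ w ∈ S', killedPoisson Gr S' w x =
      killedPoisson Gr (S' \ S) w x + ∑ m ∈ Λf, entranceWeight Gr S' S w m * killedPoisson Gr (S' \ S) m x := by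
  set Λ := S' \ S with hΛ
  have hΛfin : Λ.Finite := hS'.subset fun z hz => hz.1
  set PΛ : Site 2 → ℝ := fun w => killedPoisson Gr Λ w x with hPΛ
  set RHS : Site 2 → ℝ := fun w => PΛ w + ∑ m ∈ Λf, entranceWeight Gr S' S w m * PΛ m with hRHS
  have hxΛ : x ∉ Λ := fun h => hx h.1
  have hPΛ_off : ∀ z, z ∉ Λ → PΛ z = if z = x then 1 else 0 := fun z hz => killedPoisson_of_not_mem hz x
  -- no inner site is adjacent to `x` (the exits of `S` lie in `S'`)
  have hnoadj : ∀ w ∈ S, ∀ e : SRW.Dir 2, Gr.Adj w (w + SRW.stepVec e) → w + SRW.stepVec e ≠ x := by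
    intro w hw e hadj heq
    have : w + SRW.stepVec e ∈ S' := by
      by_cases h : w + SRW.stepVec e ∈ S
      · exact hSS' h
      · exact hOB ⟨h, w, hw, e, rfl, hadj⟩
    exact hx (heq ▸ this)
  -- ### the averaged mixture term
  have havg_sum : ∀ w ∈ S', killedAvg Gr (fun w => ∑ m ∈ Λf, entranceWeight Gr S' S w m * PΛ m) w =
      (∑ m ∈ Λf, entranceWeight Gr S' S w m * PΛ m) -
        ∑ m ∈ Λf, (4⁻¹ * ∑ e : SRW.Dir 2,
          if Gr.Adj m (m + SRW.stepVec e) ∧ m + SRW.stepVec e ∈ S ∧ w = m + SRW.stepVec e then (1 : ℝ) else 0) * PΛ m := by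
    intro w hw
    rw [show (fun w => ∑ m ∈ Λf, entranceWeight Gr S' S w m * PΛ m) =
        fun w => ∑ m ∈ Λf, (fun m w => entranceWeight Gr S' S w m * PΛ m) m w from rfl, killedAvg_finset_sum,
      ← Finset.sum_sub_distrib]
    refine Finset.sum_congr rfl fun m _ => ?_
    rw [show (fun w => entranceWeight Gr S' S w m * PΛ m) = fun w => PΛ m * entranceWeight Gr S' S w m from by
      funext w; ring, killedAvg_const_mul, killedAvg_entranceWeight hS' hSS' m hw]
    ring
  -- ### `RHS` is killed-harmonic on `S'`
  have hharmR : IsKilledHarmonicOn Gr RHS S' := by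
    intro w hw
    show RHS w = killedAvg Gr RHS w
    have hsplit : killedAvg Gr RHS w = killedAvg Gr PΛ w +
        killedAvg Gr (fun w => ∑ m ∈ Λf, entranceWeight Gr S' S w m * PΛ m) w := by
      rw [hRHS, ← killedAvg_add]; rfl
    rw [hsplit, havg_sum w hw]
    by_cases hwS : w ∈ S
    · -- inner site: `PΛ w = 0`, its average is the entrance sum, cancelled by the corrections
      have hwΛ : w ∉ Λ := fun h => h.2 hwS
      have h0 : PΛ w = 0 := by rw [hPΛ_off w hwΛ, if_neg]; exact fun h => hx (h ▸ hw)
      have h1 : killedAvg Gr PΛ w =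
          4⁻¹ * ∑ e : SRW.Dir 2, if Gr.Adj w (w + SRW.stepVec e) ∧ w + SRW.stepVec e ∈ Λ then PΛ (w + SRW.stepVec e) else 0 := by
        simp only [killedAvg]
        congr 1
        refine Finset.sum_congr rfl fun e _ => ?_
        by_cases ha : Gr.Adj w (w + SRW.stepVec e)
        · by_cases hz : w + SRW.stepVec e ∈ Λ
          · rw [if_pos ha, if_pos ⟨ha, hz⟩]
          · rw [if_pos ha, if_neg fun h => hz h.2, hPΛ_off _ hz, if_neg (hnoadj w hwS e ha)]
        · rw [if_neg ha, if_neg fun h => ha h.1]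
      rw [h1, sum_correction_eq Λf hΛf PΛ hwS]
      show PΛ w + ∑ m ∈ Λf, entranceWeight Gr S' S w m * PΛ m = _
      rw [h0]
      ring
    · -- annulus site: `PΛ` is harmonic there and the corrections vanish
      have hwΛ : w ∈ Λ := ⟨hw, hwS⟩
      have h1 : killedAvg Gr PΛ w = PΛ w := (killedPoisson_harmonicOn hΛfin x w hwΛ).symm
      have h2 : ∑ m ∈ Λf, (4⁻¹ * ∑ e : SRW.Dir 2,
          if Gr.Adj m (m + SRW.stepVec e) ∧ m + SRW.stepVec e ∈ S ∧ w = m + SRW.stepVec e then (1 : ℝ) else 0) * PΛ m = 0 := by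
        refine Finset.sum_eq_zero fun m _ => ?_
        rw [Finset.sum_eq_zero fun e _ => ?_, mul_zero, zero_mul]
        rw [if_neg]
        rintro ⟨-, hS, heq⟩
        exact hwS (heq ▸ hS)
      rw [h1, h2, sub_zero]
  -- ### equal exit data
  have hbd : ∀ z ∈ killedOuterBoundary Gr S', killedPoisson Gr S' z x = RHS z := by
    intro z hz
    have hzS' : z ∉ S' := hz.1
    rw [killedPoisson_of_not_mem hzS', hRHS]
    simp only
    rw [hPΛ_off z fun h => hzS' h.1, Finset.sum_eq_zero fun m _ => by rw [entranceWeight_of_not_mem hzS', zero_mul], add_zero]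
  -- ### uniqueness
  intro w hw
  exact (killedPoisson_harmonicOn hS' x).eq_of_eq_boundary hS' hharmR hbd w hw

/-- **The decomposition from an inner start**: for `u ∈ S` the annulus kernel at `u` vanishes and
`killedPoisson S' u x = ∑_{m ∈ S' ∖ S} ν(u,m) killedPoisson (S' ∖ S) m x`. [cite: LawlerLimic2010, §6.2] -/
theorem killedPoisson_eq_sum_entranceWeight_mul {S' S : Set (Site 2)} (hS' : S'.Finite) (hSS' : S ⊆ S')
    (hOB : killedOuterBoundary Gr S ⊆ S') {x : Site 2} (hx : x ∉ S')
    (Λf : Finset (Site 2)) (hΛf : ∀ m, m ∈ Λf ↔ m ∈ S' \ S) {u : Site 2} (hu : u ∈ S) :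
    killedPoisson Gr S' u x = ∑ m ∈ Λf, entranceWeight Gr S' S u m * killedPoisson Gr (S' \ S) m x := by
  have hux : u ≠ x := fun h => by subst h; exact hx (hSS' hu)
  rw [killedPoisson_eq_add_sum_entranceWeight_mul hS' hSS' hOB hx Λf hΛf u (hSS' hu),
    killedPoisson_of_not_mem (fun h : u ∈ S' \ S => h.2 hu), if_neg hux, zero_add]

/-! ### Cross-ratio bounds pass from the annulus to the big region -/

/-- **Cross-ratio bound from the annulus kernels.** Let `S ⊆ S'` be finite with the exits of `S`
inside `S'`, `Λ = S' ∖ S`, and let `x, y ∉ S'` be two exit points. If the annulus kernels satisfy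
`P_Λ(m,x) P_Λ(m',y) ≤ C P_Λ(m',x) P_Λ(m,y)` for all entrance points `m, m'` (sites of `Λ` with a
kept edge from `S`), then the big-region kernels satisfy
`P_{S'}(u,x) P_{S'}(v,y) ≤ C P_{S'}(v,x) P_{S'}(u,y)` for all `u, v ∈ S`.
[cite: ChelkakWan2021, §3.2 (3.6)] -/
theorem crossRatio_of_annulus {S' S : Set (Site 2)} (hS' : S'.Finite) (hSS' : S ⊆ S')
    (hOB : killedOuterBoundary Gr S ⊆ S') {x y : Site 2} (hx : x ∉ S') (hy : y ∉ S') {C : ℝ}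
    (hC : ∀ m ∈ S' \ S, ∀ m' ∈ S' \ S,
      (∃ e : SRW.Dir 2, Gr.Adj m (m + SRW.stepVec e) ∧ m + SRW.stepVec e ∈ S) →
      (∃ e : SRW.Dir 2, Gr.Adj m' (m' + SRW.stepVec e) ∧ m' + SRW.stepVec e ∈ S) →
      ∀ z ∈ ({x, y} : Set (Site 2)), ∀ z' ∈ ({x, y} : Set (Site 2)),
        killedPoisson Gr (S' \ S) m z * killedPoisson Gr (S' \ S) m' z' ≤
          C * (killedPoisson Gr (S' \ S) m' z * killedPoisson Gr (S' \ S) m z')) :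
    ∀ u ∈ S, ∀ v ∈ S, ∀ z ∈ ({x, y} : Set (Site 2)), ∀ z' ∈ ({x, y} : Set (Site 2)),
      killedPoisson Gr S' u z * killedPoisson Gr S' v z' ≤ C * (killedPoisson Gr S' v z * killedPoisson Gr S' u z') := by
  -- the entrance layer as the mixing set
  set Lf := (hS'.subset fun z hz => hz.1 : (S' \ S).Finite).toFinset.filter
    (fun m => ∃ e : SRW.Dir 2, Gr.Adj m (m + SRW.stepVec e) ∧ m + SRW.stepVec e ∈ S) with hLf
  set Λf := (hS'.subset fun z hz => hz.1 : (S' \ S).Finite).toFinset with hΛf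
  have hΛfmem : ∀ m, m ∈ Λf ↔ m ∈ S' \ S := fun m => Set.Finite.mem_toFinset _
  have hzS' : ∀ z ∈ ({x, y} : Set (Site 2)), z ∉ S' := by
    intro z hz; rcases hz with rfl | rfl; exacts [hx, hy]
  -- representation over the entrance layer (terms off the layer vanish)
  have hrep : ∀ u ∈ S, ∀ z ∈ ({x, y} : Set (Site 2)),
      killedPoisson Gr S' u z = ∑ m ∈ Lf, entranceWeight Gr S' S u m * killedPoisson Gr (S' \ S) m z := by
    intro u hu z hz
    rw [killedPoisson_eq_sum_entranceWeight_mul hS' hSS' hOB (hzS' z hz) Λf hΛfmem hu, hLf, Finset.sum_filter]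
    refine Finset.sum_congr rfl fun m _ => ?_
    split_ifs with h
    · rfl
    · push Not at h
      rw [entranceWeight_eq_zero_of_forall u fun e hh => h e hh.1 hh.2, zero_mul]
  refine BoundaryHarnackContraction.crossRatio_mixture S Lf ({x, y} : Set (Site 2))
    (fun u m => entranceWeight Gr S' S u m) (fun m z => killedPoisson Gr (S' \ S) m z) (fun u z => killedPoisson Gr S' u z)
    (fun u _ m _ => entranceWeight_nonneg _ _ _ _) hrep ?_
  intro m hm m' hm' z hz z' hz'
  rw [hLf, Finset.mem_filter, Set.Finite.mem_toFinset] at hm hm'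
  exact hC m hm.1 m' hm'.1 hm.2 hm'.2 z hz z' hz'

end Literature.Probability.LatticeModels
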